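import Mathlib
import Summits.Ventures.PercRepro2.LocRows
import Summits.Ventures.PercRepro2.SwRow
import Summits.Ventures.PercRepro2.SwOut
import Summits.Ventures.PercRepro2.SwAllRow
import Summits.Ventures.PercRepro2.SwOutAll
import Summits.Ventures.PercRepro2.SwOutArmFlip
import Summits.Ventures.PercRepro2.SwOutArmThm
import Summits.Ventures.PercRepro2.SwOutCoreDefs
import Summits.Ventures.PercRepro2.SwOutBigBlockDefs
import Summits.Ventures.PercRepro2.SwOutMixedBaseDefs
import Summits.Ventures.PercRepro2.SwOutMixedBaseClasses

/-!
# The mixed base: the red hull formula at a non-leaking point (blind cell PercRepro2, night-4 g17,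
2026-08-27; proofs/NIGHT4-G17.md §4‴ (corrected) and §4⁗)

At a point `q = (s, a, uP, e, f)` of the raw cube the red cluster of `h` of the realisation
`mixedReal σ q` is `h`, the red u-arms, `u` when some u-arm is red, `p` when moreover the u–p edges
are red, the h-piece when red, and the red far arms (`redSetM`) — PROVIDED the point is not leaking.
The leaking points are of two kinds: `p` in the red cluster with its outside edges red (the cluster
leaves through them), and `p` in the red cluster with the h-piece blue (the dead edges are then red
and the cluster leaves through the h-piece and its red boundary) — `LeakR` (the blue-side mirror is
handled by duality later).  This file: `redSetM`, `LeakR`, the closure of `redSetM` under red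
adjacency (`redSetM_closed`) and the hull formula (`cluster_mixedReal`).
-/

namespace Summit.Ventures.PercRepro2

namespace BigBlock

open Hull LocRows

variable {V : Type*} {E : Type*}

open scoped Classical

section RedSet

variable (h u p : V) {ι κ : Type*} (U : ι → Set V) (Ah : Set V) (F : κ → Set V)

/-- The red cluster of `h` predicted at a point `q`: `h`, the red u-arms, `u` (some red u-arm), `p`
(moreover the u–p edges red), the h-piece when red, the red far arms. -/
def redSetM (q : Pt ι κ) : Set V :=
  {h} ∪ {x | ∃ j, q.1 j = true ∧ x ∈ U j} ∪ {x | x = u ∧ ∃ j, q.1 j = true} ∪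
    {x | x = p ∧ (∃ j, q.1 j = true) ∧ q.2.2.1 = true} ∪ {x | q.2.1 = true ∧ x ∈ Ah} ∪
    {x | ∃ k, q.2.2.2.2 k = true ∧ x ∈ F k}

/-- The red-side leaks: `p` in the red cluster (some red u-arm, u–p red) with its outside edges red
(`e = false`) or with the h-piece blue (`a = false`). -/
def LeakR (q : Pt ι κ) : Prop :=
  (∃ j, q.1 j = true) ∧ q.2.2.1 = true ∧ (q.2.2.2.1 = false ∨ q.2.1 = false)

end RedSet

section Hull

variable {ends : E → Sym2 V} {σ : Config E} {h u p : V} {ι κ : Type*} {U : ι → Set V} {Ah : Set V}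
  {F : κ → Set V} (hb : MixedBase ends σ h u p U Ah F)
include hb

omit hb in
/-- Membership in `redSetM`. -/
lemma mem_redSetM_iff {q : Pt ι κ} {x : V} :
    x ∈ redSetM h u p U Ah F q ↔ x = h ∨ (∃ j, q.1 j = true ∧ x ∈ U j) ∨
      (x = u ∧ ∃ j, q.1 j = true) ∨ (x = p ∧ (∃ j, q.1 j = true) ∧ q.2.2.1 = true) ∨
      (q.2.1 = true ∧ x ∈ Ah) ∨ ∃ k, q.2.2.2.2 k = true ∧ x ∈ F k := by
  simp only [redSetM, Set.mem_union, Set.mem_singleton_iff, Set.mem_setOf_eq, or_assoc]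

/-- The colour of an edge touching a red u-arm is the base colour. -/
lemma MixedBase.mixedReal_U_red {q : Pt ι κ} {j : ι} (hj : q.1 j = true) {e : E}
    (he : e ∈ touches ends (U j)) : mixedReal ends u p U Ah F σ q e = σ e := by
  rw [hb.mixedReal_apply_U he, if_pos hj]

/-- The colour of an edge touching a blue u-arm is the opposite of the base colour. -/
lemma MixedBase.mixedReal_U_blue {q : Pt ι κ} {j : ι} (hj : q.1 j = false) {e : E}
    (he : e ∈ touches ends (U j)) : mixedReal ends u p U Ah F σ q e = !σ e := by
  rw [hb.mixedReal_apply_U he, if_neg (by simp [hj])]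

/-- **Closure**: at a point without red-side leak, `redSetM` is closed under red adjacency. -/
theorem MixedBase.redSetM_closed {q : Pt ι κ} (hq : ¬ LeakR q) :
    ∀ x ∈ redSetM h u p U Ah F q, ∀ y,
      (openGraph ends (mixedReal ends u p U Ah F σ q)).Adj x y → y ∈ redSetM h u p U Ah F q := by
  intro x hx y hxy
  obtain ⟨_, e, he, hends⟩ := openGraph_adj.1 hxy
  rw [mem_redSetM_iff] at hx ⊢
  rcases hx with hxh | ⟨j, hj, hx⟩ | ⟨hxu, j, hj⟩ | ⟨hxp, ⟨j, hj⟩, huP⟩ | ⟨ha, hx⟩ | ⟨k, hk, hx⟩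
  · -- x = h: the edge enters an arm, red iff the arm's coordinate is `true`
    rw [hxh] at hends
    rcases hb.h_edges e y hends with ⟨j, hy⟩ | hy | ⟨k, hy⟩
    · have ht : e ∈ touches ends (U j) := ⟨y, hy, h, ends_swap hends⟩
      rw [hb.mixedReal_apply_U ht] at he
      by_cases hj : q.1 j = true
      · exact Or.inr (Or.inl ⟨j, hj, hy⟩)
      · rw [if_neg hj, hb.h_red e y hends] at he; exact absurd he (by decide)
    · have ht : e ∈ touches ends Ah := ⟨y, hy, h, ends_swap hends⟩
      rw [hb.mixedReal_apply_Ah ht] at he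
      by_cases ha : q.2.1 = true
      · exact Or.inr (Or.inr (Or.inr (Or.inr (Or.inl ⟨ha, hy⟩))))
      · rw [if_neg ha, hb.h_red e y hends] at he; exact absurd he (by decide)
    · have ht : e ∈ touches ends (F k) := ⟨y, hy, h, ends_swap hends⟩
      rw [hb.mixedReal_apply_F ht] at he
      by_cases hk : q.2.2.2.2 k = true
      · exact Or.inr (Or.inr (Or.inr (Or.inr (Or.inr ⟨k, hk, hy⟩))))
      · rw [if_neg hk, hb.h_red e y hends] at he; exact absurd he (by decide)
  · -- x in a red u-arm: the edge is untouched; it stays inside, goes to h or u, or is blue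
    have ht : e ∈ touches ends (U j) := ⟨x, hx, y, hends⟩
    rw [hb.mixedReal_U_red hj ht] at he
    obtain ⟨x', y', hxy', hx', hy'⟩ := hb.ends_of_touches_U ht
    rw [hends, Sym2.eq_iff] at hxy'
    rcases hxy' with ⟨h1, h2⟩ | ⟨h1, h2⟩
    · rw [← h2] at hy'
      rcases hy' with hy | hyh | hyu | ⟨hyh, hyu, hyp, hout⟩
      · exact Or.inr (Or.inl ⟨j, hj, hy⟩)
      · exact Or.inl hyh
      · exact Or.inr (Or.inr (Or.inl ⟨hyu, j, hj⟩))
      · rw [hb.bdry_blue e x y hends (Or.inl (Or.inl (Set.mem_iUnion.2 ⟨j, hx⟩))) hyh hyu hyp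
          hout] at he
        exact absurd he (by decide)
    · -- the edge is `s(y, x)` with `y = x' ∈ U j`
      rw [← h2] at hx'
      exact Or.inr (Or.inl ⟨j, hj, hx'⟩)
  · -- x = u (some red u-arm): the edge goes into a u-arm or to p
    rw [hxu] at hends
    rcases hb.u_edges e y hends with ⟨j', hy⟩ | hyp
    · have ht : e ∈ touches ends (U j') := ⟨y, hy, u, ends_swap hends⟩
      rw [hb.mixedReal_apply_U ht] at he
      by_cases hj' : q.1 j' = true
      · exact Or.inr (Or.inl ⟨j', hj', hy⟩)
      · rw [if_neg hj', hb.u_red e y hends] at he; exact absurd he (by decide)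
    · rw [hyp] at hends
      have ht : e ∈ clsUP ends u p := hends
      rw [hb.mixedReal_apply_UP ht] at he
      by_cases huP : q.2.2.1 = true
      · exact Or.inr (Or.inr (Or.inr (Or.inl ⟨hyp, ⟨j, hj⟩, huP⟩)))
      · rw [if_neg huP, hb.u_red e p hends] at he; exact absurd he (by decide)
  · -- x = p (in the red cluster): its edges go to u, into the h-piece, or outside
    rw [hxp] at hends
    rcases hb.p_edges e y hends with hyu | hy | ⟨hyh, hyp, hyarms⟩
    · exact Or.inr (Or.inr (Or.inl ⟨hyu, j, hj⟩))
    · -- a dead edge: red only when the h-piece is blue — excluded by the leak condition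
      have ht : e ∈ touches ends Ah := ⟨y, hy, p, ends_swap hends⟩
      rw [hb.mixedReal_apply_Ah ht] at he
      by_cases ha : q.2.1 = true
      · rw [if_pos ha, hb.dead_blue e y hends hy] at he; exact absurd he (by decide)
      · exact absurd ⟨⟨j, hj⟩, huP, Or.inr (by simpa using ha)⟩ hq
    · -- an outside edge (or a u–p edge): red only when `e = false` — excluded by the leak condition
      by_cases hyu : y = u
      · exact Or.inr (Or.inr (Or.inl ⟨hyu, j, hj⟩))
      · have hyA : y ∉ Ah := fun hyA => hyarms (Or.inl (Or.inr hyA))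
        have ht : e ∈ clsExt ends u p Ah := ⟨y, hends, hyu, hyA⟩
        rw [hb.mixedReal_apply_Ext ht] at he
        by_cases hc : q.2.2.2.1 = true
        · rw [if_pos hc, hb.ext_blue e y hends hyu hyA] at he
          exact absurd he (by decide)
        · exact absurd ⟨⟨j, hj⟩, huP, Or.inl (by simpa using hc)⟩ hq
  · -- x in the red h-piece: inside, to h, a dead edge (blue), or outside (blue)
    have ht : e ∈ touches ends Ah := ⟨x, hx, y, hends⟩
    rw [hb.mixedReal_apply_Ah ht, if_pos ha] at he
    obtain ⟨x', y', hxy', hx', hy'⟩ := hb.ends_of_touches_Ah ht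
    rw [hends, Sym2.eq_iff] at hxy'
    rcases hxy' with ⟨h1, h2⟩ | ⟨h1, h2⟩
    · rw [← h2] at hy'
      rcases hy' with hy | hyh | hyp | ⟨hyh, hyu, hyp, hout⟩
      · exact Or.inr (Or.inr (Or.inr (Or.inr (Or.inl ⟨ha, hy⟩))))
      · exact Or.inl hyh
      · rw [hyp] at hends
        rw [hb.dead_blue e x (ends_swap hends) hx] at he; exact absurd he (by decide)
      · rw [hb.bdry_blue e x y hends (Or.inl (Or.inr hx)) hyh hyu hyp hout] at he
        exact absurd he (by decide)
    · rw [← h2] at hx'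
      exact Or.inr (Or.inr (Or.inr (Or.inr (Or.inl ⟨ha, hx'⟩))))
  · -- x in a red far arm: inside, to h, or outside (blue)
    have ht : e ∈ touches ends (F k) := ⟨x, hx, y, hends⟩
    rw [hb.mixedReal_apply_F ht, if_pos hk] at he
    obtain ⟨x', y', hxy', hx', hy'⟩ := hb.ends_of_touches_F ht
    rw [hends, Sym2.eq_iff] at hxy'
    rcases hxy' with ⟨h1, h2⟩ | ⟨h1, h2⟩
    · rw [← h2] at hy'
      rcases hy' with hy | hyh | ⟨hyh, hyu, hyp, hout⟩
      · exact Or.inr (Or.inr (Or.inr (Or.inr (Or.inr ⟨k, hk, hy⟩))))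
      · exact Or.inl hyh
      · rw [hb.bdry_blue e x y hends (Or.inr (Set.mem_iUnion.2 ⟨k, hx⟩)) hyh hyu hyp hout] at he
        exact absurd he (by decide)
    · rw [← h2] at hx'
      exact Or.inr (Or.inr (Or.inr (Or.inr (Or.inr ⟨k, hk, hx'⟩))))

/-- An edge inside `U j ∪ {h}` touches `U j`. -/
lemma MixedBase.touches_U_of_within {j : ι} {e : E} (he : e ∈ within ends (U j ∪ {h})) :
    e ∈ touches ends (U j) := by
  obtain ⟨x, hx, y, hy, hxy⟩ := he
  rcases hx with hx | hx
  · exact ⟨x, hx, y, hxy⟩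
  · rcases hy with hy | hy
    · exact ⟨y, hy, x, ends_swap hxy⟩
    · exfalso
      rw [Set.mem_singleton_iff] at hx hy
      subst hx; subst hy
      exact hb.loop_h e hxy

/-- An edge inside `Ah ∪ {h}` touches `Ah`. -/
lemma MixedBase.touches_Ah_of_within {e : E} (he : e ∈ within ends (Ah ∪ {h})) :
    e ∈ touches ends Ah := by
  obtain ⟨x, hx, y, hy, hxy⟩ := he
  rcases hx with hx | hx
  · exact ⟨x, hx, y, hxy⟩
  · rcases hy with hy | hy
    · exact ⟨y, hy, x, ends_swap hxy⟩
    · exfalso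
      rw [Set.mem_singleton_iff] at hx hy
      subst hx; subst hy
      exact hb.loop_h e hxy

/-- An edge inside `F k ∪ {h}` touches `F k`. -/
lemma MixedBase.touches_F_of_within {k : κ} {e : E} (he : e ∈ within ends (F k ∪ {h})) :
    e ∈ touches ends (F k) := by
  obtain ⟨x, hx, y, hy, hxy⟩ := he
  rcases hx with hx | hx
  · exact ⟨x, hx, y, hxy⟩
  · rcases hy with hy | hy
    · exact ⟨y, hy, x, ends_swap hxy⟩
    · exfalso
      rw [Set.mem_singleton_iff] at hx hy
      subst hx; subst hy
      exact hb.loop_h e hxy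

/-- The red edges of the base inside a red u-arm (with `h`) are red in the realisation. -/
lemma MixedBase.insideConfig_U_le {q : Pt ι κ} {j : ι} (hj : q.1 j = true) :
    insideConfig ends (U j ∪ {h}) σ ≤ mixedReal ends u p U Ah F σ q := by
  intro e
  by_cases he : insideConfig ends (U j ∪ {h}) σ e = true
  · rw [he]
    obtain ⟨hσe, hw⟩ := insideConfig_eq_true_iff.1 he
    rw [hb.mixedReal_U_red hj (hb.touches_U_of_within hw), hσe]
  · simp only [Bool.not_eq_true] at he
    rw [he]
    exact Bool.false_le _

/-- The red edges of the base inside the red h-piece (with `h`) are red in the realisation. -/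
lemma MixedBase.insideConfig_Ah_le {q : Pt ι κ} (ha : q.2.1 = true) :
    insideConfig ends (Ah ∪ {h}) σ ≤ mixedReal ends u p U Ah F σ q := by
  intro e
  by_cases he : insideConfig ends (Ah ∪ {h}) σ e = true
  · rw [he]
    obtain ⟨hσe, hw⟩ := insideConfig_eq_true_iff.1 he
    rw [hb.mixedReal_apply_Ah (hb.touches_Ah_of_within hw), if_pos ha, hσe]
  · simp only [Bool.not_eq_true] at he
    rw [he]
    exact Bool.false_le _

/-- The red edges of the base inside a red far arm (with `h`) are red in the realisation. -/
lemma MixedBase.insideConfig_F_le {q : Pt ι κ} {k : κ} (hk : q.2.2.2.2 k = true) :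
    insideConfig ends (F k ∪ {h}) σ ≤ mixedReal ends u p U Ah F σ q := by
  intro e
  by_cases he : insideConfig ends (F k ∪ {h}) σ e = true
  · rw [he]
    obtain ⟨hσe, hw⟩ := insideConfig_eq_true_iff.1 he
    rw [hb.mixedReal_apply_F (hb.touches_F_of_within hw), if_pos hk, hσe]
  · simp only [Bool.not_eq_true] at he
    rw [he]
    exact Bool.false_le _

/-- **The red hull formula**: at a point without red-side leak, the red cluster of `h` is
`redSetM` (assuming an edge between `u` and `p`). -/
theorem MixedBase.cluster_mixedReal (hup : ∃ e, ends e = s(u, p)) {q : Pt ι κ} (hq : ¬ LeakR q) :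
    cluster ends (mixedReal ends u p U Ah F σ q) h = redSetM h u p U Ah F q := by
  apply Set.Subset.antisymm
  · intro v hv
    exact mem_of_conn_of_closed (hb.redSetM_closed hq) (by rw [mem_redSetM_iff]; exact Or.inl rfl) hv
  · intro v hv
    rw [mem_redSetM_iff] at hv
    -- `u` is red-connected to `h` as soon as some u-arm is red
    have hu : (∃ j, q.1 j = true) → u ∈ cluster ends (mixedReal ends u p U Ah F σ q) h := by
      rintro ⟨j, hj⟩
      obtain ⟨e, x, hex, hx⟩ := hb.u_adj_U j
      have hxc : x ∈ cluster ends (mixedReal ends u p U Ah F σ q) h :=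
        cluster_mono (hb.insideConfig_U_le hj) h (hb.U_conn j x hx)
      have hred : mixedReal ends u p U Ah F σ q e = true := by
        rw [hb.mixedReal_U_red hj ⟨x, hx, u, ends_swap hex⟩]
        exact hb.u_red e x hex
      exact mem_cluster_of_edge hxc hred (ends_swap hex)
    rcases hv with hvh | ⟨j, hj, hv⟩ | ⟨hvu, hs⟩ | ⟨hvp, hs, huP⟩ | ⟨ha, hv⟩ | ⟨k, hk, hv⟩
    · rw [hvh]; exact mem_cluster_self _ _ _
    · exact cluster_mono (hb.insideConfig_U_le hj) h (hb.U_conn j v hv)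
    · rw [hvu]; exact hu hs
    · rw [hvp]
      obtain ⟨e, hup⟩ := hup
      have hred : mixedReal ends u p U Ah F σ q e = true := by
        rw [hb.mixedReal_apply_UP hup, if_pos huP]
        exact hb.u_red e p hup
      exact mem_cluster_of_edge (hu hs) hred hup
    · exact cluster_mono (hb.insideConfig_Ah_le ha) h (hb.Ah_conn v hv)
    · exact cluster_mono (hb.insideConfig_F_le hk) h (hb.F_conn k v hv)

end Hull

end BigBlock

end Summit.Ventures.PercRepro2
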